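import Summits.NavierStokesRegularity.NavierStokesRegularity.Theorems.QuantisedSymmetryPolyhedralDssProfileExistsStubWitnessPortraitIII
import Summits.NavierStokesRegularity.NavierStokesRegularity.Theorems.QuantisedSymmetryPolyhedralDssProfileExistsStubTraceC1
import Summits.NavierStokesRegularity.NavierStokesRegularity.Theorems.QuantisedSymmetryPolyhedralDssProfileExistsStubWeakDivCurlLiouville
import Summits.NavierStokesRegularity.NavierStokesRegularity.Theorems.QuantisedSymmetryPolyhedralDssProfileExistsStubTraceCurlWeak
import Summits.NavierStokesRegularity.NavierStokesRegularity.Theorems.QuantisedSymmetryPolyhedralDssProfileExistsStubScarForwardDss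
import Summits.NavierStokesRegularity.NavierStokesRegularity.Theorems.QuantisedSymmetryPolyhedralDssProfileExistsStubAxisAlignment
import Summits.NavierStokesRegularity.NavierStokesRegularity.Theorems.QuantisedSymmetryPolyhedralDssProfileExistsStubCurlEquivariant
import Literature.Analysis.FluidPDE.FlatSwirlGauge
import HarnessLib

/-!
# The portrait of a witness, IV — the VORTICITY SCAR, its symmetry, and the forward continuation —
  crux stmt-NavierStokesRegularity-1404 (`QuantisedSymmetry.PolyhedralDssProfileExists`), line polyhedral_cell,
  stub stub_witnessPortraitIV (N33, lead c17)

Registered assembly stub `stub_witnessPortraitIV` (`--supports stmt-NavierStokesRegularity-1404`). For every witness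
`(G, c, u, C₀)` of the crux with `G` a group of rotations (`det = 1`; finiteness and irreducibility not needed), the
Oseen-gauge representative `V` and its blow-up-time trace `V₀` of portrait III (`stub_witnessPortraitIII`) satisfy
moreover: `V₀` is `C¹` off the origin with `|x|² |DV₀| ≤ K` and the slice vorticities converge,
`curl V(t,x) → curl V₀(x)` (N29 `stub_traceC1`); the distributional curl of `V₀` on `ℝ³` is its pointwise curl (N31
`stub_traceCurlWeak`); the **vorticity scar `ω₀ = curl V₀` is not identically zero** off the origin (else `V₀` would be
weakly curl free, weakly divergence free with `|V₀| ≤ C₀/|x|`, hence zero by the weak div–curl Liouville theorem N30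
`stub_weakDivCurlLiouville`, contradicting portrait III); `ω₀` is `G`-equivariant (N26 `stub_curlEquivariant` on the
slices, then the limit) and DSS-homogeneous of degree `−2`; on every rotation axis of `G` both `V₀` and `ω₀` point along
the axis (N20 `stub_axisAlignment`); and the scar is admissible Bradshaw–Tsai datum: the blow-up continues as a forward
`c`-DSS local Leray solution from `V₀` (N32 `stub_scarForwardDss`).
-/

noncomputable section

-- the summit namespace `…NavierStokesRegularity.NavierStokesRegularity…` is the tree convention (D-0017)
set_option linter.dupNamespace false

namespace Summit.NavierStokesRegularity.NavierStokesRegularity.Theorems.PolyhedralDssProfileExists.PolyhedralCell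

open MeasureTheory Set Function Filter Topology
open Literature.Analysis Literature.Analysis.FluidPDE
open scoped InnerProductSpace RealInnerProductSpace

/-- A field continuous on `{x ≠ 0}` in `ℝ³` which vanishes a.e. vanishes at every `x ≠ 0` (nonempty open sets have
positive Lebesgue measure). [folklore] -/
theorem portraitIV_eq_zero_of_ae {W : EuclideanSpace ℝ (Fin 3) → EuclideanSpace ℝ (Fin 3)}
    (hW : ContinuousOn W {x | x ≠ 0}) (hae : W =ᵐ[volume] 0) {x : EuclideanSpace ℝ (Fin 3)} (hx : x ≠ 0) :
    W x = 0 := by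
  by_contra hne
  -- `W ≠ 0` on an open neighbourhood of `x` inside `{x ≠ 0}`
  have hopen : IsOpen {y : EuclideanSpace ℝ (Fin 3) | y ≠ 0} := isOpen_ne
  have hcont : ContinuousAt W x := hW.continuousAt (hopen.mem_nhds hx)
  have hU : {y : EuclideanSpace ℝ (Fin 3) | W y ≠ 0} ∈ 𝓝 x :=
    hcont.preimage_mem_nhds (isOpen_ne.mem_nhds hne)
  have hpos : 0 < volume {y : EuclideanSpace ℝ (Fin 3) | W y ≠ 0} :=
    lt_of_lt_of_le (Measure.measure_pos_of_mem_nhds volume hU) le_rfl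
  have hzero : volume {y : EuclideanSpace ℝ (Fin 3) | W y ≠ 0} = 0 := by
    have h : ∀ᵐ y ∂volume, W y = 0 := by
      filter_upwards [hae] with y hy
      simpa using hy
    exact ae_iff.1 h
  exact absurd hzero hpos.ne'

/-- **Homogeneity of the curl of a (−1)-homogeneous field**: if `V₀ (c • x) = c⁻¹ • V₀ x` for all `x` (`c ≠ 0`) then
`curl V₀ (c • x) = (c ^ 2)⁻¹ • curl V₀ x` — no differentiability needed (junk-consistent chain rule
`curl_smul_comp_smul`). [folklore] -/
theorem portraitIV_curl_homogeneous {V₀ : EuclideanSpace ℝ (Fin 3) → EuclideanSpace ℝ (Fin 3)} {c : ℝ}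
    (hc : c ≠ 0) (hhom : ∀ x, V₀ (c • x) = c⁻¹ • V₀ x) (x : EuclideanSpace ℝ (Fin 3)) :
    curl V₀ (c • x) = (c ^ 2)⁻¹ • curl V₀ x := by
  have h1 : curl (fun y => (1 : ℝ) • V₀ (c • y)) x = (1 * c) • curl V₀ (c • x) :=
    curl_smul_comp_smul V₀ 1 c x
  have h2 : curl (fun y => c⁻¹ • V₀ ((1 : ℝ) • y)) x = (c⁻¹ * 1) • curl V₀ ((1 : ℝ) • x) :=
    curl_smul_comp_smul V₀ c⁻¹ 1 x
  have hfun : (fun y => (1 : ℝ) • V₀ (c • y)) = fun y => c⁻¹ • V₀ ((1 : ℝ) • y) := by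
    funext y
    rw [one_smul, one_smul, hhom]
  rw [hfun, h2] at h1
  simp only [one_smul, one_mul, mul_one] at h1
  -- `h1 : c⁻¹ • curl V₀ x = c • curl V₀ (c • x)`
  have h3 : curl V₀ (c • x) = c⁻¹ • (c⁻¹ • curl V₀ x) := by
    rw [h1, smul_smul, inv_mul_cancel₀ hc, one_smul]
  rw [h3, smul_smul, ← mul_inv, ← sq]

/-- **The portrait of a witness, IV (registered assembly stub N33, lead c17).** See the module docstring.
Assembly of N24 (p169435), N29 (p170122), N30 (p169998), N31 (p170209), N32 (p169703), N20 (p167874), N26 (p169415).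
[sources: the cited stubs; folklore] -/
theorem stub_witnessPortraitIV :
    ∀ (G : Subgroup (EuclideanSpace ℝ (Fin 3) ≃ₗᵢ[ℝ] EuclideanSpace ℝ (Fin 3))) (c : ℝ)
      (u : ℝ → EuclideanSpace ℝ (Fin 3) → EuclideanSpace ℝ (Fin 3)) (C₀ : ℝ),
      (∀ g ∈ G, LinearMap.det (g.toLinearEquiv : EuclideanSpace ℝ (Fin 3) →ₗ[ℝ] EuclideanSpace ℝ (Fin 3)) = 1) →
      1 < c → IsAncientMildSolution 1 u → (∀ t < 0, AEStronglyMeasurable (u t) volume) →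
      IsDiscretelySelfSimilar c u → HasTypeIDecay C₀ u → (∀ g ∈ G, ∀ t x, u t (g x) = g (u t x)) →
      ¬ (∀ t < 0, u t =ᵐ[volume] 0) →
      ∃ (V : ℝ → EuclideanSpace ℝ (Fin 3) → EuclideanSpace ℝ (Fin 3)) (C : ℝ)
        (p : ℝ → EuclideanSpace ℝ (Fin 3) → ℝ) (V₀ : EuclideanSpace ℝ (Fin 3) → EuclideanSpace ℝ (Fin 3)),
        IsTypeIAncientMild C V ∧ HasTypeIDecay C₀ V ∧ (∀ t < 0, V t =ᵐ[volume] u t) ∧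
        IsDiscretelySelfSimilar c V ∧ (∀ g ∈ G, ∀ t x, V t (g x) = g (V t x)) ∧
        IsClassicalNSSolutionOn (Set.Iio 0) 1 0 V p ∧
        V₀ 0 = 0 ∧ (∀ x, x ≠ 0 → Tendsto (fun t => V t x) (𝓝[<] 0) (𝓝 (V₀ x))) ∧
        (∀ x, ‖x‖ * ‖V₀ x‖ ≤ C₀) ∧ (∀ x, V₀ (c • x) = c⁻¹ • V₀ x) ∧ (∀ g ∈ G, ∀ x, V₀ (g x) = g (V₀ x)) ∧
        (∃ x, V₀ x ≠ 0) ∧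
        DifferentiableOn ℝ V₀ {x | x ≠ 0} ∧ ContinuousOn (fderiv ℝ V₀) {x | x ≠ 0} ∧
        (∀ x, x ≠ 0 → Tendsto (fun t => curl (V t) x) (𝓝[<] 0) (𝓝 (curl V₀ x))) ∧
        (∃ K : ℝ, ∀ x, ‖x‖ ^ 2 * ‖fderiv ℝ V₀ x‖ ≤ K) ∧
        (∀ ψ : EuclideanSpace ℝ (Fin 3) → EuclideanSpace ℝ (Fin 3),
          Literature.Analysis.FunctionSpaces.IsTestFunctionOn
            (⊤ : TopologicalSpace.Opens (EuclideanSpace ℝ (Fin 3))) ψ →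
          ∫ x, ⟪V₀ x, curl ψ x⟫_ℝ = ∫ x, ⟪curl V₀ x, ψ x⟫_ℝ) ∧
        (∃ x, x ≠ 0 ∧ curl V₀ x ≠ 0) ∧
        (∀ g ∈ G, ∀ x, x ≠ 0 → curl V₀ (g x) = g (curl V₀ x)) ∧
        (∀ x, curl V₀ (c • x) = (c ^ 2)⁻¹ • curl V₀ x) ∧
        (∀ g ∈ G, g ≠ 1 → ∀ e : EuclideanSpace ℝ (Fin 3), e ≠ 0 → g e = e → ∀ r : ℝ,
          (∃ μ : ℝ, V₀ (r • e) = μ • e) ∧ (r ≠ 0 → ∃ μ : ℝ, curl V₀ (r • e) = μ • e)) ∧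
        (∃ (v : ℝ → EuclideanSpace ℝ (Fin 3) → EuclideanSpace ℝ (Fin 3)) (π : ℝ → EuclideanSpace ℝ (Fin 3) → ℝ),
          IsLocalLeraySolution 1 V₀ v π ∧ IsDiscretelySelfSimilar c v) := by
  intro G c u C₀ hdet hc hanc hmeas hdss hdec hequ hnt
  obtain ⟨V, C, p, V₀, hV, hVdec, hae, hVdss, hVequ, hcl, hV00, hV0cont, hV0lim, hV0bd, hV0hom, hV0equ,
    hV0loc, hV0div, hV0weak, hV0ne, -, -, -, -⟩ :=
    stub_witnessPortraitIII G c u C₀ hc hanc hmeas hdss hdec hequ hnt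
  -- ## N29: regularity of the scar and convergence of the vorticities
  obtain ⟨hdiff, hcont1, -, hcurl, K, hK⟩ := stub_traceC1 V C C₀ V₀ hV hVdec hV0lim
  -- ## N31: the weak curl is the pointwise curl
  have hweakcurl := stub_traceCurlWeak V₀ C₀ K hdiff hcont1 hV0bd hK
  -- ## the vorticity scar is nonzero (N30)
  have hc0 : c ≠ 0 := (one_pos.trans hc).ne'
  have hω : ∃ x, x ≠ 0 ∧ curl V₀ x ≠ 0 := by
    by_contra h
    simp only [not_exists, not_and, not_not] at h
    -- weakly curl free
    have hwc : ∀ ψ : EuclideanSpace ℝ (Fin 3) → EuclideanSpace ℝ (Fin 3),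
        Literature.Analysis.FunctionSpaces.IsTestFunctionOn
          (⊤ : TopologicalSpace.Opens (EuclideanSpace ℝ (Fin 3))) ψ →
        ∫ x, ⟪V₀ x, curl ψ x⟫_ℝ = 0 := by
      intro ψ hψ
      rw [hweakcurl ψ hψ]
      have hz : (fun x => ⟪curl V₀ x, ψ x⟫_ℝ) =ᵐ[volume] fun _ => (0 : ℝ) := by
        have hnull : ∀ᵐ x ∂(volume : Measure (EuclideanSpace ℝ (Fin 3))), x ∈ ({0} : Set (EuclideanSpace ℝ (Fin 3)))ᶜ :=
          compl_mem_ae_iff.2 (measure_singleton _)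
        filter_upwards [hnull] with x hx
        rw [h x (Set.mem_compl_singleton_iff.1 hx), inner_zero_left]
      rw [integral_congr_ae hz, integral_zero]
    -- a.e. envelope
    have hCnn : 0 ≤ C₀ := by simpa using hV0bd 0
    have henv : ∀ᵐ x ∂(volume : Measure (EuclideanSpace ℝ (Fin 3))), ‖V₀ x‖ ≤ C₀ / ‖x‖ := by
      have hnull : ∀ᵐ x ∂(volume : Measure (EuclideanSpace ℝ (Fin 3))), x ∈ ({0} : Set (EuclideanSpace ℝ (Fin 3)))ᶜ :=
        compl_mem_ae_iff.2 (measure_singleton _)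
      filter_upwards [hnull] with x hx
      rw [le_div_iff₀ (norm_pos_iff.2 (Set.mem_compl_singleton_iff.1 hx)), mul_comm]
      exact hV0bd x
    have hzero := stub_weakDivCurlLiouville V₀ C₀ hV0loc hV0div hwc henv
    obtain ⟨x, hx⟩ := hV0ne
    by_cases hx0 : x = 0
    · exact hx (hx0 ▸ hV00)
    · exact hx (portraitIV_eq_zero_of_ae hV0cont hzero hx0)
  -- ## equivariance of the vorticity scar (N26 on the slices, then the limit)
  have hωequ : ∀ g ∈ G, ∀ x, x ≠ 0 → curl V₀ (g x) = g (curl V₀ x) := by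
    intro g hg x hx
    have hgx : g x ≠ 0 := fun h0 => hx (by simpa using congrArg g.symm h0)
    have h1 : Tendsto (fun t => curl (V t) (g x)) (𝓝[<] 0) (𝓝 (curl V₀ (g x))) := hcurl (g x) hgx
    have h2 : Tendsto (fun t => g (curl (V t) x)) (𝓝[<] 0) (𝓝 (g (curl V₀ x))) :=
      (g.continuous.tendsto _).comp (hcurl x hx)
    have heq : ∀ᶠ t in 𝓝[<] (0 : ℝ), curl (V t) (g x) = g (curl (V t) x) := by
      filter_upwards [self_mem_nhdsWithin] with t ht
      exact stub_curlEquivariant g (hdet g hg) (V t) ((hV.contDiff_slice ht).differentiable (by simp))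
        (fun y => hVequ g hg t y) x
    exact tendsto_nhds_unique (h1.congr' heq) h2
  -- ## axis structure (N20 for `V₀` and for the vorticity scar extended by `0` at the origin)
  have haxis : ∀ g ∈ G, g ≠ 1 → ∀ e : EuclideanSpace ℝ (Fin 3), e ≠ 0 → g e = e → ∀ r : ℝ,
      (∃ μ : ℝ, V₀ (r • e) = μ • e) ∧ (r ≠ 0 → ∃ μ : ℝ, curl V₀ (r • e) = μ • e) := by
    intro g hg hg1 e he hge r
    refine ⟨stub_axisAlignment G hdet g hg hg1 e he hge V₀ hV0equ r, fun hr => ?_⟩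
    classical
    set w : EuclideanSpace ℝ (Fin 3) → EuclideanSpace ℝ (Fin 3) := fun x => if x = 0 then 0 else curl V₀ x
      with hw
    have hwequ : ∀ h ∈ G, ∀ x, w (h x) = h (w x) := by
      intro h hh x
      by_cases hx : x = 0
      · simp [hw, hx]
      · have hhx : h x ≠ 0 := fun h0 => hx (by simpa using congrArg h.symm h0)
        simp [hw, hx, hhx, hωequ h hh x hx]
    obtain ⟨μ, hμ⟩ := stub_axisAlignment G hdet g hg hg1 e he hge w hwequ r
    have hre : r • e ≠ 0 := smul_ne_zero hr he
    refine ⟨μ, ?_⟩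
    simpa [hw, hre] using hμ
  -- ## forward continuation (N32)
  have hfwd := stub_scarForwardDss V₀ C₀ c hV0loc.aestronglyMeasurable hV0div hV0bd hc hV0hom
  exact ⟨V, C, p, V₀, hV, hVdec, hae, hVdss, hVequ, hcl, hV00, hV0lim, hV0bd, hV0hom, hV0equ, hV0ne, hdiff, hcont1,
    hcurl, ⟨K, hK⟩, hweakcurl, hω, hωequ, fun x => portraitIV_curl_homogeneous hc0 hV0hom x, haxis, hfwd⟩

end Summit.NavierStokesRegularity.NavierStokesRegularity.Theorems.PolyhedralDssProfileExists.PolyhedralCell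

end
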